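import Summits.Schanuel.Schanuel.Theorems.RootDecomp1HCurveHullTowers

/-!
# RootDecomp1H ∩ RootDecomp1J — CONVERGENCE THEOREM, part 2: the CURVE HULL 𝓚 of route 1J and the TOWER HULL 𝒯̂ (merge lemma)

`SchanuelOn`, `CurveCond`, `curveStep`, `elStep`, `bakerStarSpan`, `expLogHull`, `curveHull`, `IsCurveClosed` — abbreviations of the literal
subspace in the texts of 1J's items (`schanuelOverCurveClosedFields_iff` by `Iff.rfl`-level unfolding); `tower_mem_of_isCurveClosed` (a free tower lies
coordinatewise in every curve-closed subspace on which Schanuel holds), `towerSchanuel_of_schanuelOn`; the tower hull `towerHullSet` = union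
of the ℚ-spans of the ℚ-free tower tuples, the MERGE LEMMA `exists_tower_merge` (under `TowerSchanuel` two free towers sit inside ONE: peel the
last storey; submodular count), hence `towerHull hTS : Submodule ℚ ℂ`.  Port of lens-5 `prover/RootDecomp1HCurveHull.port.lean` §§2–3 (critic ACCEPTED
08:21:52Z); 0 sorry.
-/

set_option linter.dupNamespace false

noncomputable section

namespace Summit.Schanuel.Schanuel.Theorems.RootDecomp1HCurveHull

open Complex Set
open Summit.Schanuel.Schanuel.Theses.RootDecomp1H (ProductSchanuel RelTowerSchanuel BridgeTransverse)
open Summit.Schanuel.Schanuel.Theses.RootDecomp1J (SchanuelOverCurveClosedFields PairBlocksOverCurveClosedFields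
  SchanuelOverPairClosedFields SchanuelOverCurveClosedFieldsGlue)
open Summit.Schanuel.Schanuel.Theorems.RootDecomp1HTowerCells (trdeg_adjoin_adjoin_eq adjoin_le_of_mem_span_int
  trdeg_le_of_mem_span_int exists_scaled_family linearIndependent_scaled trdeg_le_of_depthOne trdeg_adjoin_union_le
  trdeg_adjoin_range_le)
open Summit.Schanuel.Schanuel.Theorems.RootDecomp1HProductCells (eRk_le_of_span_eq le_trdeg_of_natCast_le_eRk)
open Summit.Schanuel.Schanuel.Theorems.RootDecomp1HHull (prefix_subset prefix_trdeg_le_of_eq hull_of_product_of_relTower)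
open Summit.Schanuel.Schanuel.Theorems.RootDecomp1DFlagSplit (schanuelOn_of_relOn)
open Summit.Schanuel.Schanuel.Theorems.RootDecomp1JPairSplit (schanuelOverCurveClosedFieldsGlue_holds)
open Literature.NumberTheory.Transcendental (OneMotiveToric.trdeg_mono trdeg_adjoin_le_of_le exists_nsmul_mem_span_int
  mem_adjoin_of_mem_span_int)

/-! ## 2. Route 1J's curve hull `𝓚` (the literal subspace of its items, abbreviated) -/

/-- Schanuel on the tuples of a `ℚ`-subspace `K`. -/
def SchanuelOn (K : Submodule ℚ ℂ) : Prop :=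
  ∀ (n : ℕ) (x : Fin n → ℂ), (∀ i, x i ∈ K) → LinearIndependent ℚ x →
    (n : Cardinal) ≤ Algebra.trdeg ℚ ↥(IntermediateField.adjoin ℚ (Set.range x ∪ Set.range (Complex.exp ∘ x)))

/-- 1J's curve condition: `g` has relative depth `≤ 1` over the field of the finite set `Y` (verbatim). -/
def CurveCond (Y : Finset ℂ) (g : ℂ) : Prop :=
  Algebra.trdeg ↥(IntermediateField.adjoin ℚ ((↑Y : Set ℂ) ∪ Complex.exp '' ↑Y)) ↥(IntermediateField.adjoin ↥(IntermediateField.adjoin ℚ ((↑Y : Set ℂ) ∪ Complex.exp '' ↑Y)) ({g, Complex.exp g} : Set ℂ)) ≤ 1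

/-- 1J's CURVE STEP (verbatim from `RootDecomp1J.CurvePointsOverExpLogFields`). -/
def curveStep (E : Submodule ℚ ℂ) : Submodule ℚ ℂ :=
  E ⊔ Submodule.span ℚ {g : ℂ | ∃ Y : Finset ℂ, (↑Y : Set ℂ) ⊆ ↑E ∧ CurveCond Y g}

/-- 1J's E/L-STEP (verbatim). -/
def elStep (E : Submodule ℚ ℂ) : Submodule ℚ ℂ :=
  (E ⊔ Submodule.span ℚ (Complex.exp '' ↑E)) ⊔ Submodule.span ℚ (Complex.exp ⁻¹' ↑(E ⊔ Submodule.span ℚ (Complex.exp '' ↑E)))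

/-- 1J's inhomogeneous Baker span `𝓛⋆` (verbatim). -/
def bakerStarSpan : Submodule ℚ ℂ :=
  Submodule.span ℚ ({z : ℂ | IsAlgebraic ℚ z} ∪ {z : ℂ | ∃ β l : ℂ, IsAlgebraic ℚ β ∧ IsAlgebraic ℚ (Complex.exp l) ∧ z = β * l})

/-- 1J's exp–log hull `𝓜 = ⨆ₙ elStep^[n+1] 𝓛⋆` (verbatim). -/
def expLogHull : Submodule ℚ ℂ := ⨆ n : ℕ, elStep^[n + 1] bakerStarSpan

/-- 1J's CURVE HULL `𝓚 = ⨆ₙ curveStep^[n+1] 𝓜` (verbatim). -/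
def curveHull : Submodule ℚ ℂ := ⨆ n : ℕ, curveStep^[n + 1] expLogHull

/-- `K` is CURVE-CLOSED. -/
def IsCurveClosed (K : Submodule ℚ ℂ) : Prop := curveStep K ≤ K

/-- Token check: 1J's residual `K₂` IS relative Schanuel over `𝓚`-fields for all tuples free mod `𝓚` (the literal elaborates to
`curveHull` definitionally). -/
theorem schanuelOverCurveClosedFields_iff : SchanuelOverCurveClosedFields ↔
    ∀ (k m : ℕ) (y : Fin k → ℂ) (z : Fin m → ℂ), (∀ i, y i ∈ curveHull) → LinearIndependent ℚ (curveHull.mkQ ∘ z) →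
      (m : Cardinal) ≤ Algebra.trdeg ↥(IntermediateField.adjoin ℚ (Set.range y ∪ Set.range (Complex.exp ∘ y)))
        ↥(IntermediateField.adjoin ↥(IntermediateField.adjoin ℚ (Set.range y ∪ Set.range (Complex.exp ∘ y)))
          (Set.range z ∪ Set.range (Complex.exp ∘ z))) := Iff.rfl

/-- A curve-closed subspace contains every `g` on a curve over a finite subset of it. -/
theorem mem_of_isCurveClosed {K : Submodule ℚ ℂ} (hK : IsCurveClosed K) {Y : Finset ℂ} {g : ℂ}
    (hY : (↑Y : Set ℂ) ⊆ ↑K) (hg : CurveCond Y g) : g ∈ K :=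
  hK (Submodule.mem_sup_right (Submodule.subset_span ⟨Y, hY, hg⟩))

/-- The curve condition depends only on the generated set of the finite base. -/
theorem curveCond_iff_of_eq {Y : Finset ℂ} {S : Set ℂ} (h : (↑Y : Set ℂ) ∪ Complex.exp '' ↑Y = S) (g : ℂ) :
    CurveCond Y g ↔ Algebra.trdeg ↥(IntermediateField.adjoin ℚ S)
      ↥(IntermediateField.adjoin ↥(IntermediateField.adjoin ℚ S) ({g, Complex.exp g} : Set ℂ)) ≤ 1 := by
  subst h
  rfl

/-- **(←) Free towers live in every curve-closed subspace on which Schanuel holds.** -/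
theorem tower_mem_of_isCurveClosed (K : Submodule ℚ ℂ) (hK : IsCurveClosed K) (hS : SchanuelOn K) :
    ∀ (N : ℕ) (b : Fin N → ℂ), LinearIndependent ℚ b → TowerTuple b → ∀ i, b i ∈ K := by
  intro N
  induction N with
  | zero => intro b _ _ i; exact i.elim0
  | succ N ih =>
    intro b hb htow i
    classical
    let b' : Fin N → ℂ := b ∘ Fin.castSucc
    have hb'li : LinearIndependent ℚ b' := hb.comp _ (Fin.castSucc_injective N)
    have hb'tow : TowerTuple b' := towerTuple_castSucc htow
    have hb'K : ∀ i, b' i ∈ K := ih b' hb'li hb'tow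
    rcases Fin.eq_castSucc_or_eq_last i with ⟨j, rfl⟩ | rfl
    · exact hb'K j
    let Y : Finset ℂ := Finset.univ.image b'
    have hYr : (↑Y : Set ℂ) = range b' := by
      simp only [Y, Finset.coe_image, Finset.coe_univ, Set.image_univ]
    have hYK : (↑Y : Set ℂ) ⊆ ↑K := by
      rw [hYr]
      exact Set.range_subset_iff.mpr hb'K
    have hSY : (↑Y : Set ℂ) ∪ Complex.exp '' ↑Y = range b' ∪ range (cexp ∘ b') := by
      rw [hYr, ← Set.range_comp cexp b']
    refine mem_of_isCurveClosed hK hYK ((curveCond_iff_of_eq hSY _).mpr ?_)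
    set L' : IntermediateField ℚ ℂ := IntermediateField.adjoin ℚ (range b' ∪ range (cexp ∘ b')) with hL'
    set g : ℂ := b (Fin.last N) with hg
    have hN : (N : Cardinal) ≤ Algebra.trdeg ℚ L' := hS N b' hb'K hb'li
    have htower : Algebra.trdeg ℚ L' + Algebra.trdeg L' (IntermediateField.adjoin L' ({g, cexp g} : Set ℂ)) =
        Algebra.trdeg ℚ ↥(IntermediateField.adjoin ℚ ((range b' ∪ range (cexp ∘ b')) ∪ ({g, cexp g} : Set ℂ))) :=
      trdeg_adjoin_adjoin_eq (K := ℚ) _ _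
    have hsub : (range b' ∪ range (cexp ∘ b')) ∪ ({g, cexp g} : Set ℂ) ⊆ range b ∪ range (cexp ∘ b) := by
      rintro a ((⟨j, rfl⟩ | ⟨j, rfl⟩) | ha)
      · exact Or.inl ⟨Fin.castSucc j, rfl⟩
      · exact Or.inr ⟨Fin.castSucc j, rfl⟩
      · rcases ha with rfl | rfl
        · exact Or.inl ⟨Fin.last N, rfl⟩
        · exact Or.inr ⟨Fin.last N, rfl⟩
    have hup : Algebra.trdeg ℚ ↥(IntermediateField.adjoin ℚ ((range b' ∪ range (cexp ∘ b')) ∪ ({g, cexp g} : Set ℂ))) ≤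
        ((N + 1 : ℕ) : Cardinal) :=
      (OneMotiveToric.trdeg_mono (IntermediateField.adjoin.mono ℚ _ _ hsub)).trans (trdeg_le_of_towerTuple htow)
    have hsum : Algebra.trdeg ℚ L' + Algebra.trdeg L' (IntermediateField.adjoin L' ({g, cexp g} : Set ℂ)) ≤
        ((N + 1 : ℕ) : Cardinal) := htower.le.trans hup
    obtain ⟨r, hr⟩ := Cardinal.lt_aleph0.mp ((le_add_self.trans hsum).trans_lt (Cardinal.natCast_lt_aleph0 (n := N + 1)))
    obtain ⟨d, hd⟩ := Cardinal.lt_aleph0.mp ((le_self_add.trans hsum).trans_lt (Cardinal.natCast_lt_aleph0 (n := N + 1)))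
    rw [hr, hd] at hsum
    rw [hd] at hN
    rw [hr]
    norm_cast at hsum hN ⊢
    omega

/-- Hence Schanuel on a curve-closed subspace implies TOWER SCHANUEL. -/
theorem towerSchanuel_of_schanuelOn (K : Submodule ℚ ℂ) (hK : IsCurveClosed K) (hS : SchanuelOn K) : TowerSchanuel :=
  fun n b htow hb => hS n b (tower_mem_of_isCurveClosed K hK hS n b hb htow) hb

/-- One curve step enlarges the subspace. -/
theorem le_curveStep (E : Submodule ℚ ℂ) : E ≤ curveStep E := le_sup_left

/-- An iterated curve hull `⨆ₙ curveStep^[n+1] X` is curve-closed (a finite `Y` inside the increasing union lies in one stage). -/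
theorem isCurveClosed_iSup_iterate (X : Submodule ℚ ℂ) : IsCurveClosed (⨆ n : ℕ, curveStep^[n + 1] X) := by
  classical
  have hchain : Monotone fun n : ℕ => curveStep^[n + 1] X := by
    refine monotone_nat_of_le_succ fun n => ?_
    show curveStep^[n + 1] X ≤ curveStep^[n + 1 + 1] X
    rw [Function.iterate_succ_apply' curveStep (n + 1)]
    exact le_curveStep _
  have hdir : Directed (· ≤ ·) fun n : ℕ => curveStep^[n + 1] X := hchain.directed_le
  refine sup_le le_rfl ?_
  rw [Submodule.span_le]
  rintro g ⟨Y, hY, hcond⟩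
  choose! idx hidx using fun y (hy : y ∈ Y) =>
    (Submodule.mem_iSup_of_directed (fun n : ℕ => curveStep^[n + 1] X) hdir).mp (hY (Finset.mem_coe.mpr hy))
  have hYn : (↑Y : Set ℂ) ⊆ ↑(curveStep^[Y.sup idx + 1] X) := fun y hy =>
    hchain (Finset.le_sup (Finset.mem_coe.mp hy)) (hidx y (Finset.mem_coe.mp hy))
  have hg' : g ∈ curveStep (curveStep^[Y.sup idx + 1] X) :=
    Submodule.mem_sup_right (Submodule.subset_span ⟨Y, hYn, hcond⟩)
  rw [← Function.iterate_succ_apply' curveStep (Y.sup idx + 1)] at hg'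
  exact Submodule.mem_iSup_of_mem (Y.sup idx + 1) hg'

/-- 1J's curve hull `𝓚` is curve-closed. -/
theorem isCurveClosed_curveHull : IsCurveClosed curveHull := isCurveClosed_iSup_iterate expLogHull

/-! ## 3. The tower hull `𝒯̂`; under `TowerSchanuel` it is a `ℚ`-subspace (the merge lemma) -/

/-- The TOWER HULL `𝒯̂` as a set: the union of the `ℚ`-spans of the `ℚ`-free tower tuples. -/
def towerHullSet : Set ℂ :=
  {x | ∃ (N : ℕ) (b : Fin N → ℂ), LinearIndependent ℚ b ∧ TowerTuple b ∧ x ∈ Submodule.span ℚ (range b)}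

/-- `0` lies in the tower hull. -/
theorem zero_mem_towerHullSet : (0 : ℂ) ∈ towerHullSet :=
  ⟨0, Fin.elim0, linearIndependent_empty_type, towerTuple_elim0, Submodule.zero_mem _⟩

/-- A depth-one number (`trdeg ℚ(z, e^z) ≤ 1`) lies in the tower hull (as a tower of length one, or `0`). -/
theorem mem_towerHullSet_of_depthOne {z : ℂ} (hz : Algebra.trdeg ℚ ↥(IntermediateField.adjoin ℚ ({z, cexp z} : Set ℂ)) ≤ 1) :
    z ∈ towerHullSet := by
  by_cases h0 : z = 0
  · rw [h0]; exact zero_mem_towerHullSet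
  · exact ⟨1, fun _ : Fin 1 => z, (linearIndependent_unique_iff (v := fun _ : Fin 1 => z)).2 h0,
      towerTuple_of_depthOne fun _ => hz, Submodule.subset_span ⟨0, rfl⟩⟩

/-- **THE MERGE LEMMA** (under `TowerSchanuel`): a free tower `c` and a free tower `b'` sit inside ONE free tower. -/
theorem exists_tower_merge (hTS : TowerSchanuel) {L : ℕ} {c : Fin L → ℂ} (hc : LinearIndependent ℚ c)
    (hctow : TowerTuple c) :
    ∀ (M : ℕ) (b' : Fin M → ℂ), LinearIndependent ℚ b' → TowerTuple b' →
      ∃ (L' : ℕ) (c' : Fin L' → ℂ), LinearIndependent ℚ c' ∧ TowerTuple c' ∧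
        Submodule.span ℚ (range c) ≤ Submodule.span ℚ (range c') ∧
          Submodule.span ℚ (range b') ≤ Submodule.span ℚ (range c') := by
  intro M
  induction M with
  | zero =>
    intro b' _ _
    exact ⟨L, c, hc, hctow, le_rfl, Submodule.span_le.2 (by rintro _ ⟨i, _⟩; exact i.elim0)⟩
  | succ M ih =>
    intro b' hb' hb'tow
    classical
    let b₀ : Fin M → ℂ := b' ∘ Fin.castSucc
    have hb₀li : LinearIndependent ℚ b₀ := hb'.comp _ (Fin.castSucc_injective M)
    have hb₀tow : TowerTuple b₀ := towerTuple_castSucc hb'tow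
    obtain ⟨L₁, c₁, hc₁, hc₁tow, hcc₁, hb₀c₁⟩ := ih b₀ hb₀li hb₀tow
    have hb₀mem : ∀ j, b₀ j ∈ Submodule.span ℚ (range c₁) := fun j => hb₀c₁ (Submodule.subset_span ⟨j, rfl⟩)
    obtain ⟨Msc, hMsc, hMsc_mem⟩ := exists_scaled_family c₁ b₀ hb₀mem
    let u : Fin M → ℂ := fun j => (Msc j : ℚ) • b₀ j
    have hu_li : LinearIndependent ℚ u := linearIndependent_scaled hb₀li Msc hMsc
    have hu_tow : TowerTuple u := towerTuple_smul hb₀tow (fun j => (Msc j : ℚ)) fun j => Nat.cast_ne_zero.2 (hMsc j)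
    have hu_c₁ : ∀ j, u j ∈ Submodule.span ℤ (range c₁) := hMsc_mem
    have hu_b' : ∀ j, u j ∈ Submodule.span ℤ (range b') := by
      intro j
      show (Msc j : ℚ) • b' (Fin.castSucc j) ∈ Submodule.span ℤ (range b')
      rw [Nat.cast_smul_eq_nsmul]
      exact nsmul_mem (Submodule.subset_span (Set.mem_range_self (Fin.castSucc j))) (Msc j)
    set w : ℂ := b' (Fin.last M) with hw
    set S₁ : Set ℂ := range c₁ ∪ range (cexp ∘ c₁) with hS₁
    set Su : Set ℂ := range u ∪ range (cexp ∘ u) with hSu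
    set T : Set ℂ := ({w, cexp w} : Set ℂ) with hT
    set L₁F : IntermediateField ℚ ℂ := IntermediateField.adjoin ℚ S₁ with hL₁F
    set Fu : IntermediateField ℚ ℂ := IntermediateField.adjoin ℚ Su with hFu
    set Fb' : IntermediateField ℚ ℂ := IntermediateField.adjoin ℚ (range b' ∪ range (cexp ∘ b')) with hFb'
    have hFuL₁ : Fu ≤ L₁F := adjoin_le_of_mem_span_int c₁ u hu_c₁
    have hM_le : (M : Cardinal) ≤ Algebra.trdeg ℚ Fu := hTS M u hu_tow hu_li
    have hL₁_le : Algebra.trdeg ℚ L₁F ≤ (L₁ : Cardinal) := trdeg_le_of_towerTuple hc₁tow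
    have htower₁ : Algebra.trdeg ℚ L₁F + Algebra.trdeg L₁F (IntermediateField.adjoin L₁F T) =
        Algebra.trdeg ℚ ↥(IntermediateField.adjoin ℚ (S₁ ∪ T)) := trdeg_adjoin_adjoin_eq (K := ℚ) S₁ T
    have htoweru : Algebra.trdeg ℚ Fu + Algebra.trdeg Fu (IntermediateField.adjoin Fu T) =
        Algebra.trdeg ℚ ↥(IntermediateField.adjoin ℚ (Su ∪ T)) := trdeg_adjoin_adjoin_eq (K := ℚ) Su T
    have hbase : Algebra.trdeg L₁F (IntermediateField.adjoin L₁F T) ≤ Algebra.trdeg Fu (IntermediateField.adjoin Fu T) :=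
      trdeg_adjoin_le_of_le hFuL₁ T
    have hSuT : IntermediateField.adjoin ℚ (Su ∪ T) ≤ Fb' := by
      rw [IntermediateField.adjoin_le_iff]
      rintro a ((⟨j, rfl⟩ | ⟨j, rfl⟩) | rfl | rfl)
      · exact (mem_adjoin_of_mem_span_int b' (hu_b' j)).1
      · exact (mem_adjoin_of_mem_span_int b' (hu_b' j)).2
      · exact IntermediateField.subset_adjoin ℚ _ (Or.inl ⟨Fin.last M, rfl⟩)
      · exact IntermediateField.subset_adjoin ℚ _ (Or.inr ⟨Fin.last M, rfl⟩)
    have hup : Algebra.trdeg ℚ ↥(IntermediateField.adjoin ℚ (Su ∪ T)) ≤ ((M + 1 : ℕ) : Cardinal) :=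
      (OneMotiveToric.trdeg_mono hSuT).trans (trdeg_le_of_towerTuple hb'tow)
    have hsum : Algebra.trdeg ℚ Fu + Algebra.trdeg Fu (IntermediateField.adjoin Fu T) ≤ ((M + 1 : ℕ) : Cardinal) :=
      htoweru.le.trans hup
    obtain ⟨r, hr⟩ := Cardinal.lt_aleph0.mp ((le_add_self.trans hsum).trans_lt (Cardinal.natCast_lt_aleph0 (n := M + 1)))
    obtain ⟨d, hd⟩ := Cardinal.lt_aleph0.mp ((le_self_add.trans hsum).trans_lt (Cardinal.natCast_lt_aleph0 (n := M + 1)))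
    have hr1 : Algebra.trdeg Fu (IntermediateField.adjoin Fu T) ≤ 1 := by
      rw [hr, hd] at hsum
      rw [hd] at hM_le
      rw [hr]
      norm_cast at hsum hM_le ⊢
      omega
    have hg : Algebra.trdeg ℚ ↥(IntermediateField.adjoin ℚ (S₁ ∪ T)) ≤ ((L₁ + 1 : ℕ) : Cardinal) := by
      rw [← htower₁, Nat.cast_succ]
      exact add_le_add hL₁_le (hbase.trans hr1)
    obtain ⟨L', c', hc', hc'tow, hc₁c', hwc'⟩ := exists_tower_extension hc₁ hc₁tow hg
    refine ⟨L', c', hc', hc'tow, hcc₁.trans hc₁c', Submodule.span_le.2 ?_⟩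
    rintro _ ⟨i, rfl⟩
    rcases Fin.eq_castSucc_or_eq_last i with ⟨j, rfl⟩ | rfl
    · exact hc₁c' (hb₀c₁ (Submodule.subset_span ⟨j, rfl⟩))
    · exact hwc'

/-- Under tower Schanuel the tower hull is closed under addition (merge lemma). -/
theorem add_mem_towerHullSet (hTS : TowerSchanuel) {x y : ℂ} (hx : x ∈ towerHullSet) (hy : y ∈ towerHullSet) :
    x + y ∈ towerHullSet := by
  obtain ⟨N, b, hb, hbtow, hxb⟩ := hx
  obtain ⟨M, b', hb', hb'tow, hyb'⟩ := hy
  obtain ⟨L, c, hc, hctow, hbc, hb'c⟩ := exists_tower_merge hTS hb hbtow M b' hb' hb'tow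
  exact ⟨L, c, hc, hctow, add_mem (hbc hxb) (hb'c hyb')⟩

/-- The tower hull is closed under rational scalars. -/
theorem smul_mem_towerHullSet (q : ℚ) {x : ℂ} (hx : x ∈ towerHullSet) : q • x ∈ towerHullSet := by
  obtain ⟨N, b, hb, hbtow, hxb⟩ := hx
  exact ⟨N, b, hb, hbtow, Submodule.smul_mem _ q hxb⟩

/-- **THE TOWER HULL `𝒯̂` AS A `ℚ`-SUBSPACE** (under `TowerSchanuel`). -/
def towerHull (hTS : TowerSchanuel) : Submodule ℚ ℂ where
  carrier := towerHullSet
  add_mem' := fun hx hy => add_mem_towerHullSet hTS hx hy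
  zero_mem' := zero_mem_towerHullSet
  smul_mem' := fun q _ hx => smul_mem_towerHullSet q hx

/-- Membership in `towerHull hTS` is membership in `towerHullSet` (`Iff.rfl`). -/
theorem mem_towerHull_iff (hTS : TowerSchanuel) {x : ℂ} : x ∈ towerHull hTS ↔ x ∈ towerHullSet := Iff.rfl

/-- Finitely many hull elements lie in the span of ONE free tower. -/
theorem exists_tower_of_finset (hTS : TowerSchanuel) (Y : Finset ℂ) (hY : (↑Y : Set ℂ) ⊆ towerHullSet) :
    ∃ (N : ℕ) (b : Fin N → ℂ), LinearIndependent ℚ b ∧ TowerTuple b ∧ (↑Y : Set ℂ) ⊆ ↑(Submodule.span ℚ (range b)) := by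
  classical
  induction Y using Finset.induction_on with
  | empty => exact ⟨0, Fin.elim0, linearIndependent_empty_type, towerTuple_elim0, by simp⟩
  | insert a s ha ih =>
    obtain ⟨N, b, hb, hbtow, hsb⟩ := ih ((Finset.coe_subset.mpr (Finset.subset_insert a s)).trans hY)
    obtain ⟨M, b', hb', hb'tow, hab'⟩ := hY (Finset.mem_coe.mpr (Finset.mem_insert_self a s))
    obtain ⟨L, c, hc, hctow, hbc, hb'c⟩ := exists_tower_merge hTS hb hbtow M b' hb' hb'tow
    refine ⟨L, c, hc, hctow, ?_⟩
    intro y hy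
    rcases Finset.mem_insert.mp (Finset.mem_coe.mp hy) with rfl | hy
    · exact hb'c hab'
    · exact hbc (hsb (Finset.mem_coe.mpr hy))

/-- A tuple with coordinates in `𝒯̂` lies in the span of ONE free tower. -/
theorem exists_tower_of_mem_towerHullSet (hTS : TowerSchanuel) {n : ℕ} {y : Fin n → ℂ} (h : ∀ j, y j ∈ towerHullSet) :
    ∃ (N : ℕ) (b : Fin N → ℂ), LinearIndependent ℚ b ∧ TowerTuple b ∧ ∀ j, y j ∈ Submodule.span ℚ (Set.range b) := by
  classical
  obtain ⟨N, b, hb, hbtow, hsub⟩ := exists_tower_of_finset hTS (Finset.univ.image y) (by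
    intro z hz
    obtain ⟨i, -, rfl⟩ := Finset.mem_image.mp (Finset.mem_coe.mp hz)
    exact h i)
  exact ⟨N, b, hb, hbtow, fun j => hsub (Finset.mem_coe.mpr (Finset.mem_image_of_mem y (Finset.mem_univ j)))⟩


end Summit.Schanuel.Schanuel.Theorems.RootDecomp1HCurveHull
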